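import Summits.ValiantsHypothesis.ValiantsHypothesis.Theorems.GrenetZeonDualUnipotentThreeHalvesHeavyTopDenseRatioTriangular

/-!
# `GrenetZeon.DualUnipotentThreeHalves` (stmt-ValiantsHypothesis-24318), R2 `HeavyTopLaw`: graded / filtered PROFILES ⇒ free-ratio word
# certificates, the two-level (Levi) refinement, and the typed candidate law `ThinReturnLaw` with ★ `ThinReturnLaw → DenseRatioLaw`

Port (val-lit merged desk, b71 (B) port pool; porter val-port-2 g3, 24318 line α lead; critic of record val-idea-crit-7 g2 VERDICT #17:
card #8 `graded-thin-side` rev 3 KEEP — PASS, P8-1/2/3 PAID) of val-idea-31 g3's sorry-free crux workfile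
`Cruxes/DualUnipotentThreeHalves/GradedProfileRatio.lean` @a01e5da86f030f17, RECONCILED to the landed vocabulary of ✓ p668637
`…HeavyTopRatioSpeed` (the workfile spelled `RatioSpeed` out as `RatioBound` and `Shifts` as `DegGE` only because that module was not yet in the
farm snapshot — its own docstring: «bridge `Iff.rfl`»):

* `RatioBound ρ Θ U T` ↦ ✓ `RatioSpeed ρ Θ U T` (same body); `DenseRatioBoundLaw` ↦ ✓ `DenseRatioLaw` (same body) — so the headline is
  ★ `denseRatioLaw_of_thinReturnLaw : ThinReturnLaw → DenseRatioLaw` BY NAME against the landed law;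
* `DegGE wt a X` («`a ≤ wt i − wt j` on non-zero entries») ↦ ✓ `Shifts wt a X` («`wt j + a ≤ wt i`», the same predicate up to `omega`);
  the workfile's §1 basics are the landed `shifts_one` / `shifts_mono` / `shifts_mul` (+ `shifts_zero` here);
* conjugation transport = ✓ `RatioSpeed.ratioSpeed_of_conj` / ✓ `HalfSpeed.gword_conj` (not re-proved).
Texts, statements (modulo the renaming above) and proofs are val-idea-31 g3's.

CONTENT.  §1 `gword_shifts_profile` — a word with `#Q` letters of shift `≥ c` and `#P` letters of shift `≥ −r` shifts by `≥ c·#Q − r·#P`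
(general `(r, c)`; ✓ `gword_shifts` is `c = 1`).  §2 ★ `ratioSpeed_of_profile` — PROFILE ⇒ FREE-RATIO BOUND: drops `≤ r`, climbs `≥ c ≥ 1`,
`r ≤ ρ·c`, range `≤ Θ·c` ⇒ `RatioSpeed ρ Θ U T`; `halfSpeed_of_profile` (the ratio-1 LEMMA — only the uniform ratio-1 LAWS are dead,
`Lines/half_speed_dead.md`).  §3 THE TWO-LEVEL REFINEMENT (crit-7 P8-1 «count U₀»): `lexWt`, `shifts_lex`, `shifts_lex_climb`, `lex_range`,
★ `ratioSpeed_twoLevel` — neutral (degree-0, Levi) elements that climb a SECOND level function are absorbed by the lexicographic weight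
`(M+1)·wt + wt'` at the price `ρ ↦ (M+1)ρ + M`, `Θ ↦ (M+1)Θ + M` in ratio and height, NOT in codimension.  §4 `shiftsSubmodule`, `conjLin`,
the typed law `ThinReturnLaw` (GAUGE-INVARIANT: one weight in an arbitrary basis `P`; `U` drops `≤ ρ`; the NON-climbing part of `U` — returns
AND neutral part, so `U₀` IS counted — has `4(ρ+1)·codim ≤ D`; height `⌊√D⌋/4`; density `C·d² ≤ D⌊√D⌋`), ★ `denseRatioLaw_of_thinReturnLaw`,
`ThinReturnLawIrr` (irreducible-class form), `thinReturnLawIrr_of_thinReturnLaw`.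

`ThinReturnLaw` is STRONGER than `DenseRatioLaw` (it is line α's `WeightThin` shape `(p, r, c) = (Θ, ρ, 1)` as a format-free matrix-space law);
the card's product law (PL) / thin-side bound (PB) is the REASON it should hold on irreducible graded spaces (`Cruxes/…/BiInflation.lean`).
The typed laws are `def`s, NEVER asserted; they are not lines of record.  WHY `ThinReturnLaw` MIGHT FAIL: a dense irreducible nil space with
BOTH sides fat for every flag (crit-7 V17 (b): unknown; enemies = «dense irreducible, both sides fat in every basis»).

Honest framing.  Helper lemmas + two typed candidate laws (`--supports stmt-ValiantsHypothesis-24318 --as helper`); nothing here asserts or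
proves `ThinReturnLaw`, `DenseRatioLaw`, R2 `HeavyTopLaw`, S1b, the crux, 8062 or `VP ≠ VNP` — all OPEN / NOT proved.
[val-idea-31 g3, GradedProfileRatio.lean; val-idea-30 g2 (RatioSpeed vocabulary); crit-7 g2 V17]
-/

noncomputable section

-- single-conjunct layout: Sub = Summit, duplicated namespace component intended (the name is mandated)
set_option linter.dupNamespace false
set_option autoImplicit false

namespace Summit.ValiantsHypothesis.ValiantsHypothesis.Theorems.GrenetZeon.ThinReturn

open Matrix
open Summit.ValiantsHypothesis.ValiantsHypothesis.Theorems.GrenetZeon.HalfSpeed (gword HalfSpeed gword_conj)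
open Summit.ValiantsHypothesis.ValiantsHypothesis.Theorems.GrenetZeon.RatioSpeed

section Basic

variable {ι : Type*} [Fintype ι] [DecidableEq ι]

/-! ## §1 Shift bookkeeping for general `(r, c)` profiles -/

omit [Fintype ι] [DecidableEq ι] in
/-- The zero matrix shifts by any amount. -/
theorem shifts_zero (lvl : ι → ℤ) (s : ℤ) : Shifts lvl s (0 : Matrix ι ι ℂ) :=
  fun _ _ h => absurd rfl h

/-- Shift of a two-letter word: `#Q` letters of shift `≥ c` and `#P` letters of shift `≥ −r` shift by `≥ c·#Q − r·#P`
(general `(r, c)`; ✓ `gword_shifts` is the case `c = 1`). [val-idea-31 g3 `degGE_gword`] -/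
theorem gword_shifts_profile {wt : ι → ℤ} {r c : ℤ} {P Q : Matrix ι ι ℂ} (hP : Shifts wt (-r) P) (hQ : Shifts wt c Q)
    (w : List Bool) :
    Shifts wt (c * (w.count true : ℕ) - r * (w.count false : ℕ)) (gword P Q w) := by
  induction w with
  | nil =>
    have h0 : gword P Q [] = 1 := by simp [gword]
    rw [h0]
    simpa using shifts_one (ι := ι) wt
  | cons b w ih =>
    have hcons : gword P Q (b :: w) = (if b then Q else P) * gword P Q w := by simp [gword]
    rw [hcons]
    cases b
    · have h := shifts_mul hP ih
      refine shifts_mono (le_of_eq ?_) h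
      have e1 : ((List.count true (false :: w) : ℕ) : ℤ) = (List.count true w : ℕ) := by simp
      have e2 : ((List.count false (false :: w) : ℕ) : ℤ) = (List.count false w : ℕ) + 1 := by simp
      rw [e1, e2]
      ring
    · have h := shifts_mul hQ ih
      refine shifts_mono (le_of_eq ?_) h
      have e1 : ((List.count true (true :: w) : ℕ) : ℤ) = (List.count true w : ℕ) + 1 := by simp
      have e2 : ((List.count false (true :: w) : ℕ) : ℤ) = (List.count false w : ℕ) := by simp
      rw [e1, e2]
      ring

/-! ## §2 Profile ⇒ free-ratio word bound -/

/-- ★ **PROFILE ⇒ FREE-RATIO BOUND.**  If every `P ∈ U` shifts by `≥ -r`, every `Q ∈ T` shifts by `≥ c` with `1 ≤ c`, `r ≤ ρ·c`, and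
the weight range is `≤ Θ·c`, then every non-zero word has `#Q ≤ Θ + ρ·#P` (its shift `c·#Q − r·#P` must fit under the range), i.e.
`RatioSpeed ρ Θ U T`.  The inflation `U_{p,k}`: block weights, `c = 1`, `r = ρ = p − 2`, `Θ = p − 1`, `T = J_p ⊗ M_k` of codimension `1`.
[val-idea-31 g3 `ratioBound_of_profile`] -/
theorem ratioSpeed_of_profile (wt : ι → ℤ) (r c ρ Θ : ℕ) (hc : 1 ≤ c) (hr : r ≤ ρ * c)
    (hL : ∀ i j, wt i - wt j ≤ (Θ : ℤ) * c)
    (U T : Set (Matrix ι ι ℂ)) (hU : ∀ P ∈ U, Shifts wt (-(r : ℤ)) P) (hT : ∀ Q ∈ T, Shifts wt c Q) :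
    RatioSpeed ρ Θ U T := by
  intro P hP Q hQ w hw
  obtain ⟨i, j, hij⟩ : ∃ i j, gword P Q w i j ≠ 0 := by
    by_contra h
    push Not at h
    exact hw (Matrix.ext fun i j => by simpa using h i j)
  have h1 := gword_shifts_profile (hU P hP) (hT Q hQ) w i j hij
  have h2 := hL i j
  have hf : (r : ℤ) * (w.count false : ℕ) ≤ ((ρ : ℤ) * c) * (w.count false : ℕ) :=
    mul_le_mul_of_nonneg_right (by exact_mod_cast hr) (by positivity)
  have h3 : (c : ℤ) * (w.count true : ℕ) ≤ (c : ℤ) * ((Θ : ℤ) + (ρ : ℤ) * (w.count false : ℕ)) := by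
    nlinarith
  have h4 : ((w.count true : ℕ) : ℤ) ≤ (Θ : ℤ) + (ρ : ℤ) * (w.count false : ℕ) :=
    le_of_mul_le_mul_left h3 (by exact_mod_cast hc)
  exact_mod_cast h4

/-- The ratio-1 case (`r ≤ c`) gives `HalfSpeed` — a correct LEMMA; only the uniform ratio-1 LAWS `HalfSpeedLaw` / `HalfSpeedIrrLaw` are
refuted (✓ p667569, `Lines/half_speed_dead.md`). [val-idea-31 g3] -/
theorem halfSpeed_of_profile (wt : ι → ℤ) (r c Θ : ℕ) (hrc : r ≤ c) (hc : 1 ≤ c)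
    (hL : ∀ i j, wt i - wt j ≤ (Θ : ℤ) * c)
    (U T : Set (Matrix ι ι ℂ)) (hU : ∀ P ∈ U, Shifts wt (-(r : ℤ)) P) (hT : ∀ Q ∈ T, Shifts wt c Q) :
    HalfSpeed Θ U T := by
  intro P hP Q hQ w hw
  have := ratioSpeed_of_profile wt r c 1 Θ hc (by simpa using hrc) hL U T hU hT P hP Q hQ w hw
  simpa using this

/-! ## §3 The two-level (Levi) refinement — how `U₀` is absorbed (crit-7 P8-1) -/

/-- The lexicographic weight `(M+1)·wt + wt'` for a secondary weight `wt'` with values in `[0, M]`. [val-idea-31 g3] -/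
def lexWt (wt wt' : ι → ℤ) (M : ℕ) : ι → ℤ := fun i => ((M : ℤ) + 1) * wt i + wt' i

omit [Fintype ι] [DecidableEq ι] in
/-- Coarse transfer: shift `≥ a` for `wt` gives shift `≥ (M+1)a − M` for the lexicographic weight. [val-idea-31 g3 `degGE_lex`] -/
theorem shifts_lex {wt wt' : ι → ℤ} {M : ℕ} (hM : ∀ i, 0 ≤ wt' i ∧ wt' i ≤ M) {a : ℤ} {X : Matrix ι ι ℂ}
    (hX : Shifts wt a X) : Shifts (lexWt wt wt' M) (((M : ℤ) + 1) * a - M) X := by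
  intro i j hij
  have h1 := hX i j hij
  have h2 := hM i
  have h3 := hM j
  simp only [lexWt]
  nlinarith

omit [Fintype ι] [DecidableEq ι] in
/-- **Neutral elements that climb the secondary weight climb the lexicographic weight.**  If `X` has `wt`-shift `≥ 0` and every entry
of `wt`-shift exactly `0` climbs `wt'` (shift `≥ 1`), then `X` has lexicographic shift `≥ 1`. [val-idea-31 g3 `degGE_lex_climb`] -/
theorem shifts_lex_climb {wt wt' : ι → ℤ} {M : ℕ} (hM : ∀ i, 0 ≤ wt' i ∧ wt' i ≤ M) {X : Matrix ι ι ℂ}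
    (h0 : Shifts wt 0 X) (h1 : ∀ i j, X i j ≠ 0 → wt i = wt j → 1 ≤ wt' i - wt' j) :
    Shifts (lexWt wt wt' M) 1 X := by
  intro i j hij
  have ha := h0 i j hij
  have h2 := hM i
  have h3 := hM j
  simp only [lexWt]
  by_cases he : wt i = wt j
  · have := h1 i j hij he
    rw [he]
    linarith
  · have hlt : wt j + 1 ≤ wt i := by omega
    nlinarith

omit [Fintype ι] [DecidableEq ι] in
/-- Range of the lexicographic weight: `≤ (M+1)·L + M`. [val-idea-31 g3] -/
theorem lex_range {wt wt' : ι → ℤ} {M L : ℕ} (hM : ∀ i, 0 ≤ wt' i ∧ wt' i ≤ M) (hL : ∀ i j, wt i - wt j ≤ (L : ℤ)) :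
    ∀ i j, lexWt wt wt' M i - lexWt wt wt' M j ≤ ((M : ℤ) + 1) * L + M := by
  intro i j
  have h1 := hL i j
  have h2 := hM i
  have h3 := hM j
  simp only [lexWt]
  nlinarith

/-- ★ **TWO-LEVEL CERTIFICATE.**  `U` drops `≤ r` for `wt` (range `≤ L`); `T ⊆ U` consists of elements of `wt`-shift `≥ 0` whose shift-`0`
entries climb `wt'` (values in `[0, M]`).  Then `RatioSpeed ((M+1)r + M) ((M+1)L + M) U T` — the neutral part costs a factor `M+1` in
ratio and height, NOT codimension. [val-idea-31 g3 `ratioBound_twoLevel`] -/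
theorem ratioSpeed_twoLevel (wt wt' : ι → ℤ) (r L M : ℕ) (hM : ∀ i, 0 ≤ wt' i ∧ wt' i ≤ M)
    (hL : ∀ i j, wt i - wt j ≤ (L : ℤ)) (U T : Set (Matrix ι ι ℂ))
    (hU : ∀ P ∈ U, Shifts wt (-(r : ℤ)) P)
    (hT : ∀ Q ∈ T, Shifts wt 0 Q ∧ ∀ i j, Q i j ≠ 0 → wt i = wt j → 1 ≤ wt' i - wt' j) :
    RatioSpeed ((M + 1) * r + M) ((M + 1) * L + M) U T := by
  refine ratioSpeed_of_profile (lexWt wt wt' M) ((M + 1) * r + M) 1 ((M + 1) * r + M) ((M + 1) * L + M) le_rfl (by simp)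
    ?_ U T ?_ ?_
  · intro i j
    have := lex_range (wt := wt) hM hL i j
    push_cast
    linarith
  · intro P hP
    have := shifts_lex (wt := wt) hM (hU P hP)
    refine shifts_mono (le_of_eq ?_) this
    push_cast
    ring
  · intro Q hQ
    obtain ⟨h0, h1⟩ := hT Q hQ
    simpa using shifts_lex_climb (wt := wt) hM h0 h1

/-! ## §4 The shift filtration piece as a submodule, conjugation, and the typed laws -/

/-- Matrices shifting the weight `wt` by `≥ c` (a coordinate subspace of `M_ι(ℂ)`). [val-idea-31 g3 `degGESubmodule`] -/
def shiftsSubmodule (wt : ι → ℤ) (c : ℤ) : Submodule ℂ (Matrix ι ι ℂ) where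
  carrier := {X | Shifts wt c X}
  zero_mem' := shifts_zero wt c
  add_mem' := fun hX hY => shifts_add hX hY
  smul_mem' := fun a _ hX => shifts_smul a hX

omit [Fintype ι] in
/-- Membership in `shiftsSubmodule`. -/
theorem mem_shiftsSubmodule {wt : ι → ℤ} {c : ℤ} {X : Matrix ι ι ℂ} :
    X ∈ shiftsSubmodule wt c ↔ Shifts wt c X := Iff.rfl

/-- Conjugation `X ↦ Pinv * X * P` as a linear map (no invertibility needed for linearity). [val-idea-31 g3] -/
def conjLin (Pinv P : Matrix ι ι ℂ) : Matrix ι ι ℂ →ₗ[ℂ] Matrix ι ι ℂ where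
  toFun X := Pinv * X * P
  map_add' X Y := by rw [Matrix.mul_add, Matrix.add_mul]
  map_smul' c X := by rw [Matrix.mul_smul, Matrix.smul_mul, RingHom.id_apply]

omit [DecidableEq ι] in
/-- `conjLin Pinv P X = Pinv * X * P`. -/
theorem conjLin_apply (Pinv P X : Matrix ι ι ℂ) : conjLin Pinv P X = Pinv * X * P := rfl

end Basic

/-- **`ThinReturnLaw`** (val-idea-31 g3's research conjecture, card `graded-thin-side` rev 3 — a `Prop`, typed, NOT asserted, NOT a line;
GAUGE-INVARIANT: the weight is taken in an arbitrary basis `P`).  For every DENSE linear space `U ⊆ M_d(ℂ)` of nilpotent matrices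
(`C·d² ≤ D·⌊√D⌋`, `D = dim U`) there are a basis change `P`, ONE integer weight `wt` of range `≤ ⌊√D⌋/4` and a ratio `ρ ≥ 1` such that every
`P⁻¹XP`, `X ∈ U`, shifts by `≥ -ρ` («returns are shallow») and the part of `U` that does NOT climb (shift `< 1` after conjugation: the
returns `U₋` AND the neutral part `U₀`, so `U₀` IS counted — crit-7 P8-1) has `4(ρ+1)·codim ≤ D`.  This is line α's `WeightThin` shape
`(P, lvl, p, r, c) = (P, wt, ⌊√D⌋/4, ρ, 1)` as a format-free matrix-space law, and it implies val-idea-30's ✓ `DenseRatioLaw`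
(`denseRatioLaw_of_thinReturnLaw`).  Calibration (crit-7 V17 (b)): holds on `U₄ₖ` (block weight `(3,2,1,0)`, `ρ = 2`, codim `1`), on
`U_{p,k}` (`ρ = p−2`), on generic dense `G ⊂ 𝔫_d` and on `⊕ 𝔫_b` sums.  WHY IT MIGHT FAIL: a dense irreducible nil space with BOTH sides fat
for every flag — excluded on bi-inflations with commuting coefficients by the double-centraliser product bound, conjecturally (PL) in
general.  **STATUS 2026-08-28 22:00Z: COUNTER-CANDIDATED** (crit-7 g2 VERDICT V19 (ii); val-idea-30 g3 `Ideas/ratio-knapsack.md` §(5)): the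
direct sum `E(n) = U_{p,k} ⊕ B_{⌊√n⌋}(𝔫_d)` (fat inflated return ⊕ thin long band — the «ratio knapsack» that kills line α's C⁺ `UniformWeightLaw`
on paper, V19 annex) is claimed to kill this ALL-`U` form and ✓ `DenseRatioLaw` in word currency, pending the typed write-up (price P11-3);
the IRREDUCIBLE-class form `ThinReturnLawIrr` below is NOT hit by `E(n)` (reducible).  Typed here so that either a proof or a refutation
`¬ ThinReturnLaw` can be stated BY NAME. [val-idea-31 g3] -/
def ThinReturnLaw : Prop :=
  ∃ C : ℕ, ∀ (d : ℕ) (U : Submodule ℂ (Matrix (Fin d) (Fin d) ℂ)), (∀ A ∈ U, IsNilpotent A) →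
    C * d ^ 2 ≤ Module.finrank ℂ U * Nat.sqrt (Module.finrank ℂ U) →
    ∃ (P : (Matrix (Fin d) (Fin d) ℂ)ˣ) (wt : Fin d → ℤ) (ρ : ℕ), 1 ≤ ρ ∧
      (∀ i j, wt i - wt j ≤ ((Nat.sqrt (Module.finrank ℂ U) / 4 : ℕ) : ℤ)) ∧
      (∀ X ∈ U, Shifts wt (-(ρ : ℤ)) ((↑(P⁻¹) : Matrix (Fin d) (Fin d) ℂ) * X * (P : Matrix (Fin d) (Fin d) ℂ))) ∧
      4 * (ρ + 1) * (Module.finrank ℂ U -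
        Module.finrank ℂ ↥(U ⊓ (shiftsSubmodule wt 1).comap
          (conjLin (↑(P⁻¹) : Matrix (Fin d) (Fin d) ℂ) (P : Matrix (Fin d) (Fin d) ℂ)))) ≤ Module.finrank ℂ U

/-- ★ **`ThinReturnLaw → DenseRatioLaw`** (✓ p668637's law BY NAME; same constant; certificate `T = U ∩ P·M_{≥ 1}(wt)·P⁻¹`, transported by
✓ `ratioSpeed_of_conj` and bounded by `ratioSpeed_of_profile` with `(r, c) = (ρ, 1)`). [val-idea-31 g3 `denseRatioBound_of_thinReturnLaw`] -/
theorem denseRatioLaw_of_thinReturnLaw (h : ThinReturnLaw) : DenseRatioLaw := by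
  obtain ⟨C, hC⟩ := h
  refine ⟨C, fun d U hnil hdense => ?_⟩
  obtain ⟨P, wt, ρ, hρ, hL, hU, hcod⟩ := hC d U hnil hdense
  set Pi : Matrix (Fin d) (Fin d) ℂ := ↑(P⁻¹) with hPi
  set Pm : Matrix (Fin d) (Fin d) ℂ := ↑P with hPm
  have hP1 : Pm * Pi = 1 := by rw [hPi, hPm, ← Units.val_mul, mul_inv_cancel, Units.val_one]
  have hP2 : Pi * Pm = 1 := by rw [hPi, hPm, ← Units.val_mul, inv_mul_cancel, Units.val_one]
  refine ⟨ρ, U ⊓ (shiftsSubmodule wt 1).comap (conjLin Pi Pm), hρ, inf_le_left, hcod, ?_⟩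
  refine ratioSpeed_of_conj Pi Pm hP2 hP1 ρ _ _ _ ?_
  refine ratioSpeed_of_profile wt ρ 1 ρ (Nat.sqrt (Module.finrank ℂ U) / 4) le_rfl (by simp) (by simpa using hL) _ _ ?_ ?_
  · rintro _ ⟨X, hX, rfl⟩
    exact hU X hX
  · rintro _ ⟨Y, hY, rfl⟩
    have hY' : Y ∈ U ⊓ (shiftsSubmodule wt 1).comap (conjLin Pi Pm) := hY
    have := (Submodule.mem_inf.mp hY').2
    rw [Submodule.mem_comap] at this
    exact (mem_shiftsSubmodule).mp this

/-- **`ThinReturnLawIrr`** — the IRREDUCIBLE-class form (the graded card's own target; irreducibility as in the dead β law `HalfSpeedIrrLaw`: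
no proper non-trivial common invariant subspace).  `ThinReturnLaw` for general `U` should follow from this one by the block-triangular glue
(off-diagonal blocks climb for free; diagonal = irreducible constituents; neutral parts by `ratioSpeed_twoLevel`) — that glue is NOT typed
here.  A `Prop`, NOT asserted; this is the form that SURVIVES V19 (its locus — no proper invariant subspace — excludes the direct-sum killer
`E(n)`; crit-7 V19 (iv) «irreducible-locus laws survive»). [val-idea-31 g3] -/
def ThinReturnLawIrr : Prop :=
  ∃ C : ℕ, ∀ (d : ℕ) (U : Submodule ℂ (Matrix (Fin d) (Fin d) ℂ)), (∀ A ∈ U, IsNilpotent A) →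
    (∀ V : Submodule ℂ (Fin d → ℂ), (∀ A ∈ U, ∀ x ∈ V, A *ᵥ x ∈ V) → V = ⊥ ∨ V = ⊤) →
    C * d ^ 2 ≤ Module.finrank ℂ U * Nat.sqrt (Module.finrank ℂ U) →
    ∃ (P : (Matrix (Fin d) (Fin d) ℂ)ˣ) (wt : Fin d → ℤ) (ρ : ℕ), 1 ≤ ρ ∧
      (∀ i j, wt i - wt j ≤ ((Nat.sqrt (Module.finrank ℂ U) / 4 : ℕ) : ℤ)) ∧
      (∀ X ∈ U, Shifts wt (-(ρ : ℤ)) ((↑(P⁻¹) : Matrix (Fin d) (Fin d) ℂ) * X * (P : Matrix (Fin d) (Fin d) ℂ))) ∧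
      4 * (ρ + 1) * (Module.finrank ℂ U -
        Module.finrank ℂ ↥(U ⊓ (shiftsSubmodule wt 1).comap
          (conjLin (↑(P⁻¹) : Matrix (Fin d) (Fin d) ℂ) (P : Matrix (Fin d) (Fin d) ℂ)))) ≤ Module.finrank ℂ U

/-- The general law restricts to the irreducible class (drop the hypothesis). [val-idea-31 g3] -/
theorem thinReturnLawIrr_of_thinReturnLaw (h : ThinReturnLaw) : ThinReturnLawIrr := by
  obtain ⟨C, hC⟩ := h
  exact ⟨C, fun d U hnil _ hdense => hC d U hnil hdense⟩

end Summit.ValiantsHypothesis.ValiantsHypothesis.Theorems.GrenetZeon.ThinReturn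

end
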